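import Summits.BirchSwinnertonDyer.Rank1Residual.Supersingular.X6RankZeroErratumDefs
import Summits.BirchSwinnertonDyer.Rank1Residual.Supersingular.X6RankZeroLeafHypotheses
import Summits.BirchSwinnertonDyer.Rank1Residual.Supersingular.X6RankOnePrimeConductor
import Summits.BirchSwinnertonDyer.Rank1Residual.X11b.RouteR1BDPExists
import Summits.BirchSwinnertonDyer.Rank1Residual.Partition.AnticyclotomicControlPublishedPlaces
import Literature.NumberTheory.EllipticCurves.CastellaWan2024.GreenbergMainConjectureBDP
import Literature.NumberTheory.EllipticCurves.CastellaWan2024BDPDivisibilityAtTrivialCharacter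
import Literature.NumberTheory.EllipticCurves.CuspFormLFunctionLevelConductorProofs
import Literature.NumberTheory.EllipticCurves.PAdicGrossZagierConstantTermProofs
import Literature.NumberTheory.EllipticCurves.NonvanishingTwistsPrescribedRamificationSimpleZero
import HarnessLib

/-!
# Leaf `ClassX6 ∧ r_an = 0` — road (E) interface: the erratum-prime sub-class vs the conductor, the
# rank-zero prime-conductor exclusion, the discharge at an erratum-type datum of the printed hypotheses
# of Castella–Wan 2024 Thm. 5.3 / the CW24∘Cas18 composite, and the rank-zero field supply applied
# (cell `bsd-print-x6`, typer seat `ty2`, PLAN v3 §ty2 (b) / v3.2 EDIT #4)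

HONEST FRAMING (cell `bsd-print-x6`, run/shared/lean/pub/bsd-print-x6/README.md): the cell closes the
partition leaf `ClassX6 W p ∧ W.analyticRank = 0` BY NAME from cited theorems typed exactly. THIS
FILE asserts nothing about any curve, books nothing, introduces NO definition and NO named fact (debt
0); THEOREMS ONLY, over the light defs module `X6RankZeroErratumDefs.lean` (`HasErratumPrime W p :=
∃ q prime, mult(q) ∧ nonsplit(q) ∧ p ∤ ord_q Δ_min`, the Err/Rest sub-class predicate of EDIT #4 — the
module the route imports; THIS heavier file is imported by provers, never by the route):
* §1 a witness `q` divides `N_W`; on class X6 it gives the tree's `Ram W p`;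
* §2 at analytic rank ZERO a PRIME conductor never carries an erratum prime (`w(E) = +1` forces SPLIT
  multiplicative reduction at `q = N`; contrast rank one, `X6.mult_and_not_split_of_conductorNorm_prime`)
  — the prime-conductor population of the leaf lies in the `Rest` child;
* §3 every class- and field-decidable hypothesis of `CastellaWan2024.thm53_exists_isCWBDPLFunction_charIdeal_
  map_le` (Castella–Wan 2024 Thm. 5.3 + Prop. 2.1; seat ty1, p540971) DISCHARGED in that fact's spelling at
  an erratum-type datum of an X6 pair (`GoodSS`; `Squarefree N` for the level of the newform, `= N_E` by
  Atkin–Lehner — no Carayol fact; `K` imaginary quadratic; `p` split; (gen-H) at `N⁻ = 1`; (ii) = the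
  RAMIFIED `q`; (iii)), and the fact APPLIED with only its data explicit;
* §4 the same for seat p3's COMPOSITE fact `castellaWan2024_thm53_castella2018_thm32_constantCoeff`
  (CW24 Thm. 5.3 ∘ Castella 2018 Thm. 3.2 at `𝟙`, p543331);
* §5 the rank-zero FIELD SUPPLY (`friedbergHoffstein_exists_twist_simpleZero_ramifiedAt_splitAt`, seat
  ty1, p543201) APPLIED on the `Err` sub-class: its hypotheses `w(E) = +1`, `mult`, `nonsplit`, `p ≠ q`
  discharged from `r_an = 0`, modularity and the witness.
The erratum-type SHAPE throughout = the first four conjuncts of `X11b.IsErratumField W K q` WITHOUT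
its `L`-value clause (`L(E^{(d_K)},1) ≠ 0` is the rank-ONE field; at rank zero the twist has a SIMPLE
zero), in the `ncard` spelling the field supply delivers — so both roads instantiate §3/§4.
ROUTE-INDEPENDENT: imports no `Theses` file and no `Theorems/PrintX6*` file.

NOT here (other seats): the Err-crux body (seat p3); the pack `PublishedAcInputsX6Err` (defs module,
once p3 fixes the conjunct list); the embedding datum `ι : ℚ̄_p ≃ ℂ` inducing `𝔭` (tree: `MuZeroCMKatzFrame.
exists_ringEquiv_mem_iff_norm_lt_one`); (CTL) at erratum data (`X11b.controlOnTreeGoodAt_of_thm23_embAt`).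

References: [CastellaWan2023] §2, Prop. 2.1, Thm. 5.3, proof of Thm. 6.11 (MS pp. 5, 6, 23–25, 33);
[Castella2018] §2.1, §5; [FriedbergHoffstein1995] Thm. B; [DiaconuTian2005] §2.2; [CaiShuTian2014] §1;
[AtkinLehner1970] Thm. 3; [Rohrlich1993Compositio] Prop. 2; [Marcus1977] Ch. 3; [DiamondShurman2005] §8.3.
-/

set_option autoImplicit false

noncomputable section

open scoped Classical

open WeierstrassCurve NumberField IsDedekindDomain Rat.HeightOneSpectrum
  Literature.NumberTheory.EllipticCurves
  Literature.NumberTheory.EllipticCurves.ModularForms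
  Literature.NumberTheory.EllipticCurves.Rank1Residual
  Literature.NumberTheory.EllipticCurves.Rank1Residual.Typed

namespace Summit.BirchSwinnertonDyer.Rank1Residual.Supersingular

/-! ### §1 `HasErratumPrime` (defs module) vs the conductor and class X6 -/

section Predicate

variable {W : WeierstrassCurve ℚ} [W.IsGloballyMinimal] {p : ℕ}

/-- A witness `q` of `HasErratumPrime W p` divides the conductor. [cite: DiamondShurman2005, §8.3 (PDF p. 353)] -/
theorem HasErratumPrime.exists_dvd_conductorNorm [W.IsElliptic] (h : HasErratumPrime W p) :
    ∃ q : ℕ, ∃ _ : Fact q.Prime, q ∣ W.conductorNorm ℤ ∧ Mult W q ∧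
      ¬ W.HasSplitMultiplicativeReductionAtPrime q ∧ ¬ p ∣ padicValInt q W.minimalDiscriminantInt := by
  obtain ⟨q, hq, hm, hns, hram⟩ := h
  refine ⟨q, hq, ?_, hm, hns, hram⟩
  exact (W.dvd_conductorNorm_iff_not_hasGoodReductionAtPrime q).mpr
    (WeierstrassCurve.HasMultiplicativeReduction.not_hasGoodReduction (R := ℤ_[q]) hm)

/-- On class X6 (`p` good supersingular) an erratum prime gives (ram) at `p`. [folklore] -/
theorem ClassX6.ram_of_hasErratumPrime [Fact p.Prime] (hX : ClassX6 W p) (h : HasErratumPrime W p) :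
    Ram W p := h.ram hX.1.1

end Predicate

/-! ### §2 Analytic rank ZERO and PRIME conductor: split multiplicative, hence never `Err` -/

section PrimeConductor

/-- **Prime conductor and EVEN analytic rank ⇒ SPLIT multiplicative reduction at the conductor.**
For `W/ℚ` elliptic with `N_W = q` prime and `ord_{s=1} L(E,s)` even: `w(E) = +1` (modularity,
`(−1)^{r_an}`), `w(E) = −∏ᶠ_v w_v(E) = −w_{v_q}(E)` (product formula at squarefree conductor), so
`w_{v_q} = −1`, which is neither good (`w_v = 1`) nor nonsplit multiplicative (`w_v = 1`, Rohrlich)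
nor additive (`N_W` squarefree): split multiplicative. The even twin of
`mult_and_not_split_of_conductorNorm_prime_of_odd_analyticRank`.
[cite: Rohrlich1993Compositio, Prop. 2(i)–(ii)] [cite: KellockDokchitser2023, Def. 2.1, Rem. 2.2 and Cor. 2.5] -/
theorem split_of_conductorNorm_prime_of_even_analyticRank (hnf : exists_isNewformOf)
    (W : WeierstrassCurve ℚ) [W.IsElliptic] (q : ℕ) [Fact q.Prime] (hN : W.conductorNorm ℤ = q)
    (heven : Even W.analyticRank) :
    W.HasMultiplicativeReductionAtPrime q ∧ W.HasSplitMultiplicativeReductionAtPrime q := by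
  have hq : q.Prime := Fact.out
  have hsq : Squarefree (W.conductorNorm ℤ) := by rw [hN]; exact hq.prime.squarefree
  have hw : W.rootNumber = 1 := by
    rw [WeierstrassCurve.rootNumber_eq_neg_one_pow_analyticRank_of_exists_isNewformOf hnf W]
    exact heven.neg_one_pow
  have hprod : W.rootNumber = -∏ᶠ v : HeightOneSpectrum ℤ, W.localRootNumberAt v :=
    rootNumber_eq_neg_finprod_localRootNumberAt_of_rootNumber_eq_algebraicRootNumber W
      (W.rootNumber_eq_algebraicRootNumber_of_squarefree hsq hnf)
      (fun v ha ↦ absurd ha (W.not_hasAdditiveReductionAt_of_squarefree_conductorNorm hsq v))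
  set P : Nat.Primes := ⟨q, hq⟩ with hP
  set vq : HeightOneSpectrum ℤ := (primesEquiv (R := ℤ)).symm P with hvq
  have hone : ∀ v : HeightOneSpectrum ℤ, v ≠ vq → W.localRootNumberAt v = 1 := by
    intro v hv
    by_contra hne
    have hmem := W.natGenerator_mem_primeFactors_conductorNorm_of_localRootNumberAt_ne_one hne
    rw [hN, hq.primeFactors, Finset.mem_singleton] at hmem
    apply hv
    rw [hvq, Equiv.eq_symm_apply]
    exact Subtype.ext hmem
  have hsingle : ∏ᶠ v : HeightOneSpectrum ℤ, W.localRootNumberAt v = W.localRootNumberAt vq :=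
    finprod_eq_single _ vq hone
  have hwq : W.localRootNumberAt vq = -1 := by
    have h := hprod
    rw [hw, hsingle] at h
    linarith
  have hs_v : W.HasSplitMultiplicativeReductionAt vq := by
    by_contra hs
    rcases hasGoodReductionAt_or_hasMultiplicativeReductionAt_or_hasAdditiveReductionAt vq W with
      hg | hm | ha
    · have h1 := WeierstrassCurve.localRootNumberAt_of_hasGoodReductionAt hg
      rw [hwq] at h1
      norm_num at h1
    · have h1 := localRootNumberAt_of_hasMultiplicativeReductionAt_of_not_split hm hs
      rw [hwq] at h1
      norm_num at h1
    · exact absurd ha (W.not_hasAdditiveReductionAt_of_squarefree_conductorNorm hsq vq)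
  have hbridge := W.hasSplitMultiplicativeReductionAtPrime_iff_hasSplitMultiplicativeReductionAt vq
  rw [hvq, Equiv.apply_symm_apply] at hbridge
  have hsplit : W.HasSplitMultiplicativeReductionAtPrime q := hbridge.mpr hs_v
  have hbad : ¬ W.HasGoodReductionAtPrime q :=
    (W.dvd_conductorNorm_iff_not_hasGoodReductionAtPrime q).mp (by rw [hN])
  have hmult_v : W.HasMultiplicativeReductionAt vq := by
    rcases hasGoodReductionAt_or_hasMultiplicativeReductionAt_or_hasAdditiveReductionAt vq W with
      hg | hm | ha
    · exact absurd ((W.hasGoodReductionAtPrime_iff_hasGoodReductionAt_holds P).mpr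
        (by rw [← hvq]; exact hg)) hbad
    · exact hm
    · exact absurd ha (W.not_hasAdditiveReductionAt_of_squarefree_conductorNorm hsq vq)
  have hmult : W.HasMultiplicativeReductionAtPrime q := by
    have hb := W.hasMultiplicativeReductionAtPrime_iff_hasMultiplicativeReductionAt_holds P
    rw [← hvq] at hb
    exact hb.mpr hmult_v
  exact ⟨hmult, hsplit⟩

/-- **Prime conductor and even analytic rank ⇒ NO erratum prime**: the only bad prime is `q = N_W`,
which is SPLIT multiplicative (`split_of_conductorNorm_prime_of_even_analyticRank`); so at analytic rank
zero the prime-conductor population lies in `Rest`, never in `Err` — unlike rank one, where `N = q`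
prime is Castella–Wan's own erratum case (`X6.mult_and_not_split_of_conductorNorm_prime`).
[cite: Rohrlich1993Compositio, Prop. 2(ii)] [cite: CastellaWan2023, proof of Thm. 6.11 (MS p. 33) (the rank-one case)] -/
theorem not_hasErratumPrime_of_conductorNorm_prime_of_even_analyticRank (hnf : exists_isNewformOf)
    (W : WeierstrassCurve ℚ) [W.IsElliptic] [W.IsGloballyMinimal] (p q : ℕ) [Fact q.Prime]
    (hN : W.conductorNorm ℤ = q) (heven : Even W.analyticRank) : ¬ HasErratumPrime W p := by
  rintro ⟨q', hq', hm, hns, -⟩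
  have hdvd : q' ∣ W.conductorNorm ℤ :=
    (W.dvd_conductorNorm_iff_not_hasGoodReductionAtPrime q').mpr
      (WeierstrassCurve.HasMultiplicativeReduction.not_hasGoodReduction (R := ℤ_[q']) hm)
  rw [hN] at hdvd
  have hqq : q' = q := (Nat.prime_dvd_prime_iff_eq hq'.out Fact.out).mp hdvd
  subst hqq
  exact hns (split_of_conductorNorm_prime_of_even_analyticRank hnf W q' hN heven).2

/-- **On the leaf (analytic rank `0`): a prime conductor carries no erratum prime.** [cite: Rohrlich1993Compositio, Prop. 2(ii)] -/
theorem X6RankZero.not_hasErratumPrime_of_conductorNorm_prime (hnf : exists_isNewformOf)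
    (W : WeierstrassCurve ℚ) [W.IsElliptic] [W.IsGloballyMinimal] (p q : ℕ) [Fact q.Prime]
    (hN : W.conductorNorm ℤ = q) (hr : W.analyticRank = 0) : ¬ HasErratumPrime W p :=
  not_hasErratumPrime_of_conductorNorm_prime_of_even_analyticRank hnf W p q hN (by rw [hr]; exact ⟨0, rfl⟩)

end PrimeConductor

/-! ### §3 Castella–Wan 2024 Thm. 5.3 at an erratum-type datum of an X6 pair: the class- and field-decidable
hypotheses DISCHARGED in the spelling of `CastellaWan2024.thm53_exists_isCWBDPLFunction_charIdeal_map_le` -/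

section CW24

variable {K : Type} [Field K] [NumberField K]
  (W : WeierstrassCurve ℚ) [W.IsElliptic] [W.IsGloballyMinimal] (p : ℕ) [Fact p.Prime]

/-- **The level of the newform of an X6 curve is its conductor, and is squarefree** (hypothesis (i)
of CW24 Thm. 5.3 for the level `N` of `f`): X6 ⊂ semistable ⇒ `N_W` squarefree ⇒ `N = N_W` by
Atkin–Lehner (`IsNewformOf.level_eq_conductorNorm_of_squarefree`, PROVED; Carayol's theorem not
needed). [cite: AtkinLehner1970, Thm. 3] [cite: DiamondShurman2005, Thm. 8.8.1 and (8.44)] -/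
theorem ClassX6.level_eq_conductorNorm_and_squarefree (hX : ClassX6 W p) {N : ℕ} [NeZero N]
    {f : CuspForm (CongruenceSubgroup.Gamma0 N) 2} (hf : IsNewformOf W f) :
    N = W.conductorNorm ℤ ∧ Squarefree N := by
  have hsq : Squarefree (W.conductorNorm ℤ) := ClassX6.squarefree_conductorNorm W p hX
  have hN : N = W.conductorNorm ℤ := hf.level_eq_conductorNorm_of_squarefree hsq
  exact ⟨hN, hN ▸ hsq⟩

/-- **CW24 Thm. 5.3's hypotheses at an erratum-type datum of an X6 pair — ALL the class-decidable /
field-decidable ones, in the fact's spelling.** Data: an X6 pair `(W, p)`; the newform `f` of `W`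
(level `N`); a prime `q ∣ N_W`; `K` imaginary quadratic with `q ∣ d_K`, every prime `ℓ ∣ N_W` other
than `q` split, `2` split if `2 ∤ N_W` (the erratum-type SHAPE = the first four conjuncts of
`X11b.IsErratumField W K q`, NO `L`-value clause, so the rank-zero road (twist with a simple zero) and
the rank-one road (twist value `≠ 0`) both instantiate it); `p` split. Conclusions = the binders `hss`,
`hK`, `hspl`, `hHeeg`, `hN`, `hii`, `hiii` of `CastellaWan2024.exists_isCWBDPLFunction_of_thm53`:
`GoodSS`; imaginary quadratic; `(p).primesOver.ncard = 2`; (gen-H, `N⁻ = 1`) every prime `ℓ ∣ N` has a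
prime of norm `ℓ` (`X11b.exists_absNorm_eq_of_splitsIn` / `…_of_dvd_discr`); (i) `Squarefree N`; (ii)
`q ∣ N` non-split (it ramifies); (iii) `Odd N → 2` splits.
[cite: CastellaWan2023, §2 setting (MS p. 5) and Thm. 5.3 (i)–(iii) (MS p. 23)]
[cite: Castella2018, §5 (arXiv:1704.06608 p. 12), choice of K] [cite: Marcus1977, Ch. 3 Thm. 25] -/
theorem X6.cw24_thm53_hypotheses (hX : ClassX6 W p) {N : ℕ} [NeZero N]
    {f : CuspForm (CongruenceSubgroup.Gamma0 N) 2} (hf : IsNewformOf W f)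
    {q : ℕ} (hq : q.Prime) (hqN : q ∣ W.conductorNorm ℤ)
    (hKiq : IsImaginaryQuadratic K) (hqD : (q : ℤ) ∣ NumberField.discr K)
    (hsplit : ∀ ℓ : ℕ, ℓ.Prime → ℓ ∣ W.conductorNorm ℤ → ℓ ≠ q →
      ((Ideal.span {(ℓ : ℤ)}).primesOver (𝓞 K)).ncard = 2)
    (h2 : ¬ 2 ∣ W.conductorNorm ℤ → ((Ideal.span {(2 : ℤ)}).primesOver (𝓞 K)).ncard = 2) (hHp : SatisfiesHeegnerHypothesis p K) :
    GoodSS W p ∧ IsImaginaryQuadratic K ∧ ((Ideal.span {(p : ℤ)}).primesOver (𝓞 K)).ncard = 2 ∧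
      (∀ ℓ : ℕ, ℓ.Prime → ℓ ∣ N → ∃ v : HeightOneSpectrum (𝓞 K), Ideal.absNorm v.asIdeal = ℓ) ∧
      Squarefree N ∧
      (∃ ℓ : ℕ, ℓ.Prime ∧ ℓ ∣ N ∧ ((Ideal.span {(ℓ : ℤ)}).primesOver (𝓞 K)).ncard ≠ 2) ∧
      (Odd N → ((Ideal.span {(2 : ℤ)}).primesOver (𝓞 K)).ncard = 2) := by
  obtain ⟨hN, hsqN⟩ := ClassX6.level_eq_conductorNorm_and_squarefree W p hX hf
  refine ⟨hX.1, hKiq, hHp p Fact.out (dvd_refl p), ?_, hsqN, ?_, ?_⟩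
  · -- (gen-H) with `N⁻ = 1`
    intro ℓ hℓ hℓN
    rw [hN] at hℓN
    by_cases hℓq : ℓ = q
    · subst hℓq
      exact X11b.exists_absNorm_eq_of_dvd_discr hKiq.1 hℓ hqD
    · exact X11b.exists_absNorm_eq_of_splitsIn hKiq.1 hℓ (hsplit ℓ hℓ hℓN hℓq)
  · -- (ii): the ramified `q`
    exact ⟨q, hq, hN ▸ hqN, fun hs ↦ not_dvd_discr_of_ncard_primesOver hq (by rw [hs, hKiq.1]) hqD⟩
  · -- (iii)
    intro hodd
    have h2N : ¬ 2 ∣ W.conductorNorm ℤ := by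
      rw [← hN]
      exact hodd.not_two_dvd_nat
    exact h2 h2N

/-- **Castella–Wan 2024 Thm. 5.3 APPLIED at an erratum-type datum of an X6 pair with `p ≥ 5`** — the
named fact `h53` with every class- and field-decidable hypothesis discharged (`X6.cw24_thm53_hypotheses`);
DATA left explicit: `ι` with its prime `𝔭 ∋ p` (compatibility `hι`), a second prime `𝔭̄ ∋ p`, `𝔭̄ ≠ 𝔭`
(exists: `X11b.exists_other_prime`), `κ`, `γ`, the newform `f`. Conclusion VERBATIM the fact's.
CONDITIONAL on the named fact (flags `CW24-CLW22-addendum`, `Hid04-gap`, `CW24-Thm53-inherits-CLW22-irredK`,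
`CW24-53-orientation-L33` — tier is the referee's call); nothing booked.
[cite: CastellaWan2023, Thm. 5.3 (MS pp. 23–25), Prop. 2.1 (MS pp. 5–6)] [cite: CastellaLiuWan2022, Thm. 8.2.3 (1)] -/
theorem X6.cw24_thm53_of_erratumShape
    (h53 : CastellaWan2024.thm53_exists_isCWBDPLFunction_charIdeal_map_le)
    (ι : PadicAlgCl p ≃+* ℂ) (hX : ClassX6 W p) (hp5 : 5 ≤ p)
    {N : ℕ} [NeZero N] {f : CuspForm (CongruenceSubgroup.Gamma0 N) 2} (hf : IsNewformOf W f)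
    {q : ℕ} (hq : q.Prime) (hqN : q ∣ W.conductorNorm ℤ)
    (hKiq : IsImaginaryQuadratic K) (hqD : (q : ℤ) ∣ NumberField.discr K)
    (hsplit : ∀ ℓ : ℕ, ℓ.Prime → ℓ ∣ W.conductorNorm ℤ → ℓ ≠ q →
      ((Ideal.span {(ℓ : ℤ)}).primesOver (𝓞 K)).ncard = 2)
    (h2 : ¬ 2 ∣ W.conductorNorm ℤ → ((Ideal.span {(2 : ℤ)}).primesOver (𝓞 K)).ncard = 2) (hHp : SatisfiesHeegnerHypothesis p K)
    (𝔭 𝔭bar : HeightOneSpectrum (𝓞 K)) (h𝔭 : ((p : ℕ) : 𝓞 K) ∈ 𝔭.asIdeal)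
    (hι : ∀ (w : InfinitePlace K) (k : 𝓞 K), k ∈ 𝔭.asIdeal ↔ ‖ι.symm (w.embedding (k : K))‖ < 1)
    (h𝔭bar : ((p : ℕ) : 𝓞 K) ∈ 𝔭bar.asIdeal) (hne : 𝔭bar ≠ 𝔭)
    (κ : ZpExtension K p) (hκ : κ.IsAnticyclotomic) (γ : Field.absoluteGaloisGroup K)
    [Fact (κ.IsTopGenerator γ)] :
    ∃ (ΩK : ℂ) (Ωp : (unrIntegers p)ˣ) (L : UnrSeries p),
      ΩK ≠ 0 ∧
      CastellaWan2024.IsCWBDPLFunction ι 𝔭 κ γ f (NumberField.discr K) ΩK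
        ((Ωp : unrIntegers p) : ℂ_[p]) L ∧
      ∀ (j : ℤ_[p] →+* unrIntegers p),
        (∀ x : ℤ_[p], ((j x : unrIntegers p) : ℂ_[p]) = algebraMap ℚ_[p] ℂ_[p] (x : ℚ_[p])) →
        (Literature.NumberTheory.EllipticCurves.Castella2018.AcSelmer.XAc.charIdeal
            (W.baseChange K) p κ 𝔭bar ∅ γ).map (PowerSeries.map j) ≤ Ideal.span {L} := by
  obtain ⟨hss, hK, hspl, hHeeg, hsqN, hii, hiii⟩ :=
    X6.cw24_thm53_hypotheses W p hX hf hq hqN hKiq hqD hsplit h2 hHp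
  exact h53 ι W K 𝔭 𝔭bar κ γ hf hp5 hss hK hspl h𝔭 hι h𝔭bar hne hHeeg hκ hsqN hii hiii

end CW24

/-! ### §4 The COMPOSITE "CW24 Thm. 5.3 ∘ Castella 2018 Thm. 3.2 at `𝟙`" (seat p3's named fact
`castellaWan2024_thm53_castella2018_thm32_constantCoeff`, p543331) at an erratum-type SHAPE of an X6 pair:
class hypotheses `Good`/`Semistable`/`Irr` and the field clauses discharged -/

section Composite

variable {K : Type} [Field K] [NumberField K]
variable (W : WeierstrassCurve ℚ) [W.IsElliptic] [W.IsGloballyMinimal] (p : ℕ) [Fact p.Prime]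

/-- **The composite's hypotheses at an erratum-type SHAPE of an X6 pair with `p ≥ 5`**, conjunct by
conjunct in the fact's spelling (conductor form): `Good W p`, `Semistable W` (= (i)), `Irr W p`
(a tree THEOREM on X6 at `p ≠ 2`, `ClassX6.irr`); `K` imaginary quadratic; (gen-H at `N⁻ = 1`)
`∀ ℓ ∣ N_W, ∃ v, absNorm v = ℓ`; (ii) `∃ ℓ ∣ N_W` non-split (the ramified `q`); (iii)
`¬ 2 ∣ N_W → 2` splits. The shape = first four conjuncts of `X11b.IsErratumField W K q` WITHOUT the
`L`-value clause — so the rank-ZERO road (twist with a simple zero) instantiates it.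
[cite: CastellaWan2023, §2 setting (MS p. 5) and Thm. 5.3 (i)–(iii) (MS p. 23)]
[cite: Castella2018, §2.1 (arXiv:1704.06608 p. 5) and §5 (p. 12)] [cite: Marcus1977, Ch. 3 Thm. 25] -/
theorem X6.cw24thm53_cas18thm32_hypotheses (hX : ClassX6 W p) (hp5 : 5 ≤ p)
    {q : ℕ} (hq : q.Prime) (hqN : q ∣ W.conductorNorm ℤ)
    (hKiq : IsImaginaryQuadratic K) (hqD : (q : ℤ) ∣ NumberField.discr K)
    (hsplit : ∀ ℓ : ℕ, ℓ.Prime → ℓ ∣ W.conductorNorm ℤ → ℓ ≠ q →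
      ((Ideal.span {(ℓ : ℤ)}).primesOver (𝓞 K)).ncard = 2)
    (h2 : ¬ 2 ∣ W.conductorNorm ℤ → ((Ideal.span {(2 : ℤ)}).primesOver (𝓞 K)).ncard = 2) :
    Good W p ∧ Semistable W ∧ Irr W p ∧ IsImaginaryQuadratic K ∧
      (∀ ℓ : ℕ, ℓ.Prime → ℓ ∣ W.conductorNorm ℤ →
        ∃ v : HeightOneSpectrum (𝓞 K), Ideal.absNorm v.asIdeal = ℓ) ∧
      (∃ ℓ : ℕ, ℓ.Prime ∧ ℓ ∣ W.conductorNorm ℤ ∧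
        ((Ideal.span {(ℓ : ℤ)}).primesOver (𝓞 K)).ncard ≠ 2) ∧
      (¬ 2 ∣ W.conductorNorm ℤ → ((Ideal.span {(2 : ℤ)}).primesOver (𝓞 K)).ncard = 2) := by
  have hp2 : p ≠ 2 := by omega
  refine ⟨hX.1.1, hX.2.1, ClassX6.irr W p hp2 hX, hKiq, ?_, ?_, fun h2N ↦ h2 h2N⟩
  · intro ℓ hℓ hℓN
    by_cases hℓq : ℓ = q
    · subst hℓq
      exact X11b.exists_absNorm_eq_of_dvd_discr hKiq.1 hℓ hqD
    · exact X11b.exists_absNorm_eq_of_splitsIn hKiq.1 hℓ (hsplit ℓ hℓ hℓN hℓq)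
  · exact ⟨q, hq, hqN, fun hs ↦ not_dvd_discr_of_ncard_primesOver hq (by rw [hs, hKiq.1]) hqD⟩

/-- **The composite APPLIED at an erratum-type SHAPE of an X6 pair with `p ≥ 5`** (seat p3's named
fact `h`, CONDITIONAL on it; flags travel with the fact): class and field hypotheses discharged
(`X6.cw24thm53_cas18thm32_hypotheses`); DATA left explicit exactly as in the fact (`ι : K →+* ℚ_p`
inducing `v`, the strict prime `vbar`, `(κ, γ)`, `Dt` with `p ∤ c`, the Heegner point `P` read through
`ιC`, a generator `F` of `ch_Λ(X^{rel,str})`). Conclusion VERBATIM the fact's; rank-free. Nothing booked.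
[cite: CastellaWan2023, Thm. 5.3 (MS pp. 23–25)] [cite: Castella2018, Thm. 3.2 with (3.2) (arXiv:1704.06608 p. 9)] -/
theorem X6.cw24thm53_cas18thm32_of_erratumShape
    (h : castellaWan2024_thm53_castella2018_thm32_constantCoeff) (hX : ClassX6 W p) (hp5 : 5 ≤ p)
    {q : ℕ} (hq : q.Prime) (hqN : q ∣ W.conductorNorm ℤ)
    (hKiq : IsImaginaryQuadratic K) (hqD : (q : ℤ) ∣ NumberField.discr K)
    (hsplit : ∀ ℓ : ℕ, ℓ.Prime → ℓ ∣ W.conductorNorm ℤ → ℓ ≠ q →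
      ((Ideal.span {(ℓ : ℤ)}).primesOver (𝓞 K)).ncard = 2)
    (h2 : ¬ 2 ∣ W.conductorNorm ℤ → ((Ideal.span {(2 : ℤ)}).primesOver (𝓞 K)).ncard = 2) (hHp : SatisfiesHeegnerHypothesis p K)
    (ι : K →+* ℚ_[p]) (v vbar : HeightOneSpectrum (𝓞 K))
    (hι : ∀ x : 𝓞 K, x ∈ v.asIdeal ↔ ‖ι (x : K)‖ < 1)
    (hvbar : ((p : ℕ) : 𝓞 K) ∈ vbar.asIdeal) (hne : vbar ≠ v)
    (κ : ZpExtension K p) (hκ : κ.IsAnticyclotomic) (γ : Field.absoluteGaloisGroup K)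
    [Fact (κ.IsTopGenerator γ)]
    (N : ℕ) [NeZero N] (Dt : ModularParametrizationData W N) (H : HeegnerDatum N (NumberField.discr K))
    (ιC : K →+* ℂ) (P : (W.baseChange K).toAffine.Point) (hc : ¬ (p : ℤ) ∣ Dt.c)
    (hP : WeierstrassCurve.Affine.Point.map ιC.toRatAlgHom P = heegnerPointComplex Dt H)
    (F : IwasawaAlgebra p)
    (hF : Literature.NumberTheory.EllipticCurves.Castella2018.AcSelmer.XAc.charIdeal (W.baseChange K) p
        κ vbar ∅ γ = Ideal.span {F}) :
    ∃ e : ℤ_[p],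
      ((PowerSeries.constantCoeff F : ℤ_[p]) : ℚ_[p]) =
        (e : ℚ_[p]) *
          ((1 - (W.frobeniusTrace p : ℚ_[p]) * (p : ℚ_[p])⁻¹ + (p : ℚ_[p])⁻¹) *
            ((W.baseChange ℚ_[p]).padicLogPoint (formalIndex W p • padicPointOf W p ι P) /
              (formalIndex W p : ℚ_[p]))) ^ 2 := by
  obtain ⟨hgood, hsst, hirr, hK, hHeeg, hii, hiii⟩ :=
    X6.cw24thm53_cas18thm32_hypotheses W p hX hp5 hq hqN hKiq hqD hsplit h2
  exact h W p hp5 hgood hsst hirr K hK hHeeg hii hiii hHp ι v vbar hι hvbar hne κ hκ γ N Dt H ιC P hc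
    hP F hF

end Composite

/-! ### §5 The rank-ZERO field supply APPLIED on the `Err` sub-class: an erratum-type field with `p` split
and a SIMPLE zero of the twist EXISTS (Friedberg–Hoffstein 1995 Thm. B, second alternative — seat ty1's
named fact `friedbergHoffstein_exists_twist_simpleZero_ramifiedAt_splitAt`, p543201) -/

section Supply

variable (W : WeierstrassCurve ℚ) [W.IsElliptic] [W.IsGloballyMinimal] (p : ℕ) [Fact p.Prime]

/-- **On the `Err` sub-class of the leaf, the rank-zero erratum-type datum's FIELD exists, by name.**
For an X6 pair `(W, p)` with `ord_{s=1} L(E,s) = 0` and `HasErratumPrime W p`: there are a prime `q`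
— nonsplit multiplicative with `E[p]` ramified at `q`, `q ≠ p`, `q ∣ N_W` — and an imaginary quadratic
`K` with `q ∣ d_K`, every other prime of `N_W` split, `2` split if `2 ∤ N_W`, `p` split, and
`L(E^{(d_K)},1) = 0`, `L'(E^{(d_K)},1) ≠ 0` (so `E/K` has analytic rank one). The hypotheses of the
named fact `hFH` DISCHARGED on the leaf: `w(E) = +1` ⇐ `r_an = 0` and modularity `hnf`
(`rootNumber_eq_neg_one_pow_analyticRank_of_exists_isNewformOf`); `mult`/`nonsplit` ⇐ the witness of
`HasErratumPrime`; `p ≠ q` ⇐ `p` good, `q` multiplicative (`HasErratumPrime.ne_of_good`). Output in the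
erratum-SHAPE spelling consumed by §3/§4. CONDITIONAL on the named fact (PRINT-anchored, REF PA-9b;
flags `FH95-text-not-held`, `FH95-B2-ramified-seed@DT05-scope`); nothing booked.
[cite: FriedbergHoffstein1995, Thm. B, second alternative] [cite: DiaconuTian2005, §2.2 (p. 1357)]
[cite: CastellaWan2023, proof of Thm. 6.11 (MS p. 33) (a)–(d)] [cite: SilvermanAEC2009, C.16 Thm. 16.3] -/
theorem X6RankZero.exists_erratumShapeField_of_hasErratumPrime
    (hFH : friedbergHoffstein_exists_twist_simpleZero_ramifiedAt_splitAt) (hnf : exists_isNewformOf)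
    (hX : ClassX6 W p) (hr : W.analyticRank = 0) (h : HasErratumPrime W p) :
    ∃ (q : ℕ) (_ : Fact q.Prime) (K : Type) (_ : Field K) (_ : NumberField K),
      Mult W q ∧ ¬ W.HasSplitMultiplicativeReductionAtPrime q ∧
        ¬ p ∣ padicValInt q W.minimalDiscriminantInt ∧ q ≠ p ∧ q ∣ W.conductorNorm ℤ ∧
      IsImaginaryQuadratic K ∧ (q : ℤ) ∣ NumberField.discr K ∧
        (∀ ℓ : ℕ, ℓ.Prime → ℓ ∣ W.conductorNorm ℤ → ℓ ≠ q →
          ((Ideal.span {(ℓ : ℤ)}).primesOver (𝓞 K)).ncard = 2) ∧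
        (¬ 2 ∣ W.conductorNorm ℤ → ((Ideal.span {(2 : ℤ)}).primesOver (𝓞 K)).ncard = 2) ∧
        SatisfiesHeegnerHypothesis p K ∧
          (W.quadraticTwist (NumberField.discr K : ℚ)).entireLFunction 1 = 0 ∧
          deriv (W.quadraticTwist (NumberField.discr K : ℚ)).entireLFunction 1 ≠ 0 := by
  obtain ⟨q, hq, hqN, hm, hns, hram⟩ := h.exists_dvd_conductorNorm
  have hqp : q ≠ p := HasErratumPrime.ne_of_good hX.1.1 hm
  have hw : W.rootNumber = 1 := by
    rw [WeierstrassCurve.rootNumber_eq_neg_one_pow_analyticRank_of_exists_isNewformOf hnf W, hr, pow_zero]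
  obtain ⟨K, hF, hNF, hKiq, hqD, hsplit, h2, hHp, hL0, hL1⟩ :=
    exists_ramifiedAt_splitAt_twist_simpleZero hFH W hw q hm hns (p := p) Fact.out hqp.symm
  exact ⟨q, hq, K, hF, hNF, hm, hns, hram, hqp, hqN, hKiq, hqD, hsplit, h2, hHp, hL0, hL1⟩

end Supply

end Summit.BirchSwinnertonDyer.Rank1Residual.Supersingular

end
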